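import Summits.Ventures.PercRepro.GenQTraceProfileC

/-!
# PercRepro — the trace profiles, part D: the hyperplanes through a flat (night-4, gen 11)

The cap (T8) of the two-level profile LP (sheet §65 (b) (T)): a flat `F` of rank `r` whose trace on `G` spans it
(`s` points) lies in at most `C(n − s, q − 1 − r)` rank-`(q − 1)` flats with spanning traces.  Each such hyperplane `H`
is `cl(J)` for a basis `J` of `H ∩ G` extending a fixed basis `I` of `F ∩ G`, and `J ∖ I ⊆ G ∖ F` has `q − 1 − r`
points and determines `H` (`card_hypSp_through_le`).  Imports `GenQTraceProfileC`.
-/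
namespace PercRepro.Night4

open Finset ThmH SixFour GenQ PerFlat Star

variable {α : Type*} [DecidableEq α] {M : Matroid α} [M.Finite]

/-- The rank-`(q − 1)` flats with spanning traces on `G` that contain `F`. -/
noncomputable def hypSpThrough (M : Matroid α) [M.Finite] (G F : Finset α) (q : ℕ) : Finset (Finset α) :=
  (flatsQ M (q - 1)).filter
    (fun H : Finset α => M.eRk ((H ∩ G : Finset α) : Set α) = ((q - 1 : ℕ) : ℕ∞) ∧ F ⊆ H)

/-- A flat with a spanning trace is the closure of its trace. -/
theorem coe_eq_closure_inter_of_spanning {G H : Finset α} {r : ℕ} (hH : H ∈ flatsQ M r)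
    (hHr : M.eRk ((H ∩ G : Finset α) : Set α) = (r : ℕ∞)) :
    (H : Set α) = M.closure ((H ∩ G : Finset α) : Set α) := by
  have hH' := mem_flatsQ.1 hH
  have h1 : M.closure ((H ∩ G : Finset α) : Set α) = M.closure (H : Set α) :=
    (M.isRkFinite_of_finite (Finset.finite_toSet (H ∩ G))).closure_eq_closure_of_subset_of_eRk_ge_eRk
      (Finset.coe_subset.2 Finset.inter_subset_left) (by rw [hHr, hH'.2.2])
  rw [h1, hH'.2.1.closure]

/-- **(T8)** the hyperplanes with spanning traces through a set `F` whose trace `F ∩ G` has rank `r` and `s` points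
number at most `C(n − s, q − 1 − r)` (`F` need not be a flat). -/
theorem card_hypSp_through_le {G F : Finset α} {q r s : ℕ} (hG : G ⊆ gr M)
    (hFs : (F ∩ G).card = s) (hFr : M.eRk ((F ∩ G : Finset α) : Set α) = (r : ℕ∞)) :
    (hypSpThrough M G F q).card ≤ (G.card - s).choose (q - 1 - r) := by
  classical
  have hGE : (G : Set α) ⊆ M.E := by
    rw [← coe_gr M]
    exact Finset.coe_subset.2 hG
  have hFGE : ((F ∩ G : Finset α) : Set α) ⊆ M.E := (Finset.coe_subset.2 Finset.inter_subset_right).trans hGE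
  obtain ⟨I, hI⟩ := M.exists_isBasis ((F ∩ G : Finset α) : Set α) hFGE
  have hIcard : I.encard = (r : ℕ∞) := by rw [hI.encard_eq_eRk, hFr]
  have hIF : I ⊆ (F : Set α) := hI.subset.trans (Finset.coe_subset.2 Finset.inter_subset_left)
  -- every member has a basis of its trace extending `I`
  have hext : ∀ H ∈ hypSpThrough M G F q, ∃ J : Set α, M.IsBasis J ((H ∩ G : Finset α) : Set α) ∧ I ⊆ J := by
    intro H hH
    rw [hypSpThrough, Finset.mem_filter] at hH
    have hIH : I ⊆ ((H ∩ G : Finset α) : Set α) :=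
      hI.subset.trans (Finset.coe_subset.2 (Finset.inter_subset_inter_right hH.2.2))
    exact hI.indep.subset_isBasis_of_subset hIH ((Finset.coe_subset.2 Finset.inter_subset_right).trans hGE)
  choose! J hJ using hext
  -- the extension part, as a finset of `G ∖ F`
  let X : Finset α → Finset α := fun H => (G \ F).filter (fun x => x ∈ J H)
  have hXeq : ∀ H ∈ hypSpThrough M G F q, ((X H : Finset α) : Set α) = J H \ I := by
    intro H hH
    have hHm := hH
    rw [hypSpThrough, Finset.mem_filter] at hHm
    ext x
    simp only [X, Finset.coe_filter, Finset.mem_sdiff, Set.mem_setOf_eq, Set.mem_sdiff]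
    constructor
    · rintro ⟨⟨hxG, hxF⟩, hxJ⟩
      exact ⟨hxJ, fun hxI => hxF (hIF hxI)⟩
    · rintro ⟨hxJ, hxI⟩
      have hxHG : x ∈ ((H ∩ G : Finset α) : Set α) := (hJ H hH).1.subset hxJ
      rw [Finset.mem_coe, Finset.mem_inter] at hxHG
      refine ⟨⟨hxHG.2, fun hxF => hxI ?_⟩, hxJ⟩
      -- `x ∈ F ∩ G ⊆ cl I`; with `x ∈ J` independent and `I ⊆ J ∖ x` this forces `x ∈ I`
      by_contra hxI'
      have hxcl : x ∈ M.closure I := hI.subset_closure (Finset.mem_coe.2 (Finset.mem_inter.2 ⟨hxF, hxHG.2⟩))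
      have hIJx : I ⊆ J H \ {x} := fun y hy => ⟨(hJ H hH).2 hy, fun hyx => hxI' (hyx ▸ hy)⟩
      exact (hJ H hH).1.indep.notMem_closure_sdiff_of_mem hxJ (M.closure_subset_closure hIJx hxcl)
  -- the card of the extension part
  have hXcard : ∀ H ∈ hypSpThrough M G F q, (X H).card = q - 1 - r := by
    intro H hH
    have hHm := hH
    rw [hypSpThrough, Finset.mem_filter] at hHm
    have hJcard : (J H).encard = ((q - 1 : ℕ) : ℕ∞) := by rw [(hJ H hH).1.encard_eq_eRk, hHm.2.1]
    have hJunion : J H = I ∪ ((X H : Finset α) : Set α) := by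
      rw [hXeq H hH]
      exact (Set.union_sdiff_cancel (hJ H hH).2).symm
    have hdisj : Disjoint I ((X H : Finset α) : Set α) := by
      rw [hXeq H hH]
      exact Set.disjoint_sdiff_right
    have h1 : (J H).encard = I.encard + ((X H : Finset α) : Set α).encard := by
      rw [hJunion, Set.encard_union_eq hdisj]
    rw [hJcard, hIcard, Set.encard_coe_eq_coe_finsetCard] at h1
    have h2 : q - 1 = r + (X H).card := by exact_mod_cast h1
    omega
  -- injective: `H = cl(I ∪ X H)`
  have hinj : Set.InjOn X (hypSpThrough M G F q : Set (Finset α)) := by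
    intro H hH H' hH' hXX
    have hH0 := hH; have hH0' := hH'
    rw [Finset.mem_coe, hypSpThrough, Finset.mem_filter] at hH0 hH0'
    have hJ1 : J H = I ∪ (J H \ I) := (Set.union_sdiff_cancel (hJ H hH).2).symm
    have hJ2 : J H' = I ∪ (J H' \ I) := (Set.union_sdiff_cancel (hJ H' hH').2).symm
    have hJJ : J H = J H' := by
      rw [hJ1, hJ2, ← hXeq H hH, ← hXeq H' hH', hXX]
    apply Finset.coe_injective
    rw [coe_eq_closure_inter_of_spanning hH0.1 hH0.2.1, coe_eq_closure_inter_of_spanning hH0'.1 hH0'.2.1,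
      ← (hJ H hH).1.closure_eq_closure, ← (hJ H' hH').1.closure_eq_closure, hJJ]
  -- the count
  have hmaps : ∀ H ∈ hypSpThrough M G F q, X H ∈ (G \ F).powersetCard (q - 1 - r) := by
    intro H hH
    rw [Finset.mem_powersetCard]
    exact ⟨Finset.filter_subset _ _, hXcard H hH⟩
  calc (hypSpThrough M G F q).card ≤ ((G \ F).powersetCard (q - 1 - r)).card :=
        Finset.card_le_card_of_injOn X hmaps hinj
    _ = (G.card - s).choose (q - 1 - r) := by
        rw [Finset.card_powersetCard, card_sdiff_eq_card_sub_card_inter, hFs]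

end PercRepro.Night4
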